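import Mathlib
import HarnessLib
import Summits.HubbardSuperconductivity.HubbardSuperconductivity.Theorems.KLProgrammeKLRegimeSplitTwoLegSizesMSChainTableGraded
import Summits.HubbardSuperconductivity.HubbardSuperconductivity.Theorems.KLProgrammeKLRegimeSplitTwoLegSizesMSOfPieces
import Summits.HubbardSuperconductivity.HubbardSuperconductivity.Theorems.KLProgrammeKLRegimeSplitTwoLegSizesMSTop

/-!
# Route `KLProgramme`, crux K3 — (E3a-MS) supplier, BUDGET-PARAMETRIC form, part 3: keyed by the admissible pieces / `FrameOK`, DEPTH-GRADED
# (gen-6 re-key `msBar ↦ msBarQ`, plan g14 (R12) T1b; repair MS-A34 (R-c); k3c3-p1 g4)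

Seat hubbard-kl-k3c3-p1 (g4).  The three (E3a-MS) supplier theorems with the fit hypotheses REMOVED, the conclusion the budget-parametric slot text
`TwoLegSizesMSWith … b B` at COMPUTED sizes, and — the MS-A34 repair — the chain budgets of orders 3/4 DEPTH-GRADED (`…MSChainGraded`,
`…MSChainTableGraded`) instead of the vacuous full-depth `msA3 R U N` / `msA4 R U N` of `…MSOfPieces`:

* closed forms `msA3G R U d n₀ k`, `msA4G R U d n₀ k` of the graded sums `chainSizeSumG d Kp (pieceSize R U) n₀ N k 3/4` (coarse pieces `∝ 4^{n₀}`,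
  low parts in BERNSTEIN form `24(2d+1)(1+4d)ʲ·Gfr₀|U|·16^{−n₀}/15`, high parts up to slot `n₀+k` `∝ 4^{(j−2)(n₀+k)}` — no `N` anywhere):
  `chainSizeSumG_three_le_msA3G`, `chainSizeSumG_four_le_msA4G`; the graded chain regime `chain_regime_of_pieces_graded` (orders `≤ 2` keep the
  uniform `msA R c U`, thresholds `klCurveC3 R/16`, `klCurveU0 R/16` as before);
* the computed sizes `msPieceBaseG X σ R U d n₀ = msSizeBaseO X σ (msA3G … 0) (msA4G … 0)`,
  `msPieceSlotG X σ ε R c U d n₀ m j = msSizeSlotO X σ ε (msA R c U) (msA3G … (m−n₀)) (msA4G … (m−n₀)) msDt (m ↦ msE d (pieceSize R U m)) n₀ m j`,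
  `msPieceTop X σ R U N j = extSize X (σ 0) (bellCumOsc σ (msD (topA3 R U N) (topA4 R U N)) j) j` — all with the OSCILLATION entry
  `bellCumOsc` at order `0` (`…MSProfileOsc`, repair «MS-A0»: the tadpole-sized sup `2·σ 0` no longer enters the derivative sizes);
* **`twoLegSizesMSWith_succ_of_pieces_graded`** (scale `n+1 ≤ nScales β`), **`twoLegSizesMSWith_zero_of_pieces_graded`** (scale `0`),
  **`twoLegSizesMSWith_top_of_frameOK`** (scale `nScales β + 1`, `FrameOK`-keyed, budgets `topA3/topA4`, which ARE the right scale there, oscillation entry).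

USE (any keying `𝒯` of the slot text that is `TwoLegSizesMSWith … b𝒯 B𝒯` by `Iff.rfl` — `TwoLegSizesMST`, the gen-6 `TwoLegSizesMSTQ`):
`(twoLegSizesMSWith_succ_of_pieces_graded …).mono hfit_n hfit_m : 𝒯` with `hfit_n : ∀ j ≤ 4, msPieceBaseG … j ≤ b𝒯 j`,
`hfit_m : ∀ m ∈ Ioc n₀ N, ∀ j ≤ 4, msPieceSlotG … m j ≤ B𝒯 m j` — the fits (k3c3-p3's arithmetic, symbolic in `A₃, A₄`) are the caller's only
budget-dependent lines.  Proofs only; nothing about the model.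
-/

noncomputable section

namespace Summit.HubbardSuperconductivity.HubbardSuperconductivity.Theorems.KLRegimeSplit

set_option linter.dupNamespace false -- summit = problem name (single-conjunct summit), D-0017
set_option maxSynthPendingDepth 4 -- nested operator-norm instances (symbol sizes up to order five), as in `…CompDiff`

open Real Finset Literature.MathematicalPhysics.QuantumLattice Literature.MathematicalPhysics.QuantumLattice.FermiRG
open Literature.MathematicalPhysics.QuantumLattice.BandSectorCounting
open Summit.HubbardSuperconductivity.HubbardSuperconductivity.Theorems.KLProgrammeLegKernels
open Summit.HubbardSuperconductivity.HubbardSuperconductivity.Theorems.DispersionFlow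
open Summit.HubbardSuperconductivity.HubbardSuperconductivity.Theorems.PerturbedFermiCurve

/-! ## §1 Closed forms of the depth-graded budgets in the KL regime -/

/-- The band-bound `Dt_min` numeral of the window (`cDtmin (−1.1) (−0.1)`), as the term table reads it. -/
def msDt : ℝ :=
  (bandBounds (show (-4 : ℝ) < -1.1 by norm_num) (show (-1.1 : ℝ) ≤ -0.1 by norm_num) (show (-0.1 : ℝ) < 0 by norm_num)).Dtmin

/-- **Depth-graded order-3 budget** of chain position `k` (scale `n₀`, Jackson degree `d`): coarse pieces `Gfr₃U²4^{n₀+1}/3` + low parts (Bernstein)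
`24(2d+1)(1+4d)³·Gfr₀|U|·16^{−n₀}/15` + high parts up to slot `n₀+k`: `4·Gfr₃U²4^{n₀+k+1}/3`. -/
def msA3G (R : RenConsts) (U : ℝ) (d n₀ k : ℕ) : ℝ :=
  R.Gfr 3 * U ^ 2 * ((4 : ℝ) ^ (n₀ + 1) / 3) +
    24 * (2 * (d : ℝ) + 1) * (1 + 4 * (d : ℝ)) ^ 3 * (R.Gfr 0 * |U|) * (((16 : ℝ) ^ n₀)⁻¹ / 15) +
    4 * (R.Gfr 3 * U ^ 2 * ((4 : ℝ) ^ (n₀ + k + 1) / 3))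

/-- **Depth-graded order-4 budget** of chain position `k`: `Gfr₄U²16^{n₀+1}/15 + 24(2d+1)(1+4d)⁴·Gfr₀|U|·16^{−n₀}/15 + 4·Gfr₄U²16^{n₀+k+1}/15`. -/
def msA4G (R : RenConsts) (U : ℝ) (d n₀ k : ℕ) : ℝ :=
  R.Gfr 4 * U ^ 2 * ((16 : ℝ) ^ (n₀ + 1) / 15) +
    24 * (2 * (d : ℝ) + 1) * (1 + 4 * (d : ℝ)) ^ 4 * (R.Gfr 0 * |U|) * (((16 : ℝ) ^ n₀)⁻¹ / 15) +
    4 * (R.Gfr 4 * U ^ 2 * ((16 : ℝ) ^ (n₀ + k + 1) / 15))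

/-- The geometric tail `Σ_{m ∈ Ioc n N} 16^{−m} ≤ 16^{−n}/15`. [folklore] -/
theorem sum_Ioc_sixteen_inv_le (n N : ℕ) : ∑ m ∈ Ioc n N, ((16 : ℝ) ^ m)⁻¹ ≤ ((16 : ℝ) ^ n)⁻¹ / 15 := by
  have key : ∀ N, n ≤ N → ∑ m ∈ Ioc n N, ((16 : ℝ) ^ m)⁻¹ = (((16 : ℝ) ^ n)⁻¹ - ((16 : ℝ) ^ N)⁻¹) / 15 := by
    intro N hN
    induction N with
    | zero =>
      have hn0 : n = 0 := by omega
      subst hn0; simp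
    | succ N ih =>
      rcases Nat.eq_or_lt_of_le hN with h | h
      · subst h; simp
      · rw [Finset.sum_Ioc_succ_top (by omega), ih (by omega), pow_succ, mul_inv]
        have : ((16 : ℝ) ^ N)⁻¹ = 16 * (((16 : ℝ) ^ N)⁻¹ * (16 : ℝ)⁻¹) := by field_simp
        rw [this]; ring
  by_cases hN : n ≤ N
  · rw [key N hN]
    have : 0 ≤ ((16 : ℝ) ^ N)⁻¹ := by positivity
    linarith
  · rw [Finset.Ioc_eq_empty (by omega), Finset.sum_empty]
    positivity

/-- The order-0 piece size is `Gfr₀|U|·16^{−m}`. -/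
theorem pieceSize_zero_eq (R : RenConsts) (U : ℝ) (m : ℕ) : pieceSize R U m 0 = R.Gfr 0 * |U| * ((16 : ℝ) ^ m)⁻¹ := by
  unfold pieceSize uPow
  rw [if_pos rfl, show (((0 : ℕ) : ℤ) - 2) * (m : ℤ) = -((2 * m : ℕ) : ℤ) by push_cast; ring, zpow_neg, zpow_natCast, pow_mul]
  norm_num

/-- The low parts of the deep pieces in Bernstein form sum to `24(2d+1)(1+4d)ʲ·Gfr₀|U|·16^{−n₀}/15`. -/
theorem sum_lowSize_pieceSize_le {R : RenConsts} (hR : ∀ j, 0 ≤ R.Gfr j) (U : ℝ) (d n₀ N j : ℕ) :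
    ∑ m ∈ Ioc n₀ N, lowSize d (pieceSize R U m) j ≤
      24 * (2 * (d : ℝ) + 1) * (1 + 4 * (d : ℝ)) ^ j * (R.Gfr 0 * |U|) * (((16 : ℝ) ^ n₀)⁻¹ / 15) := by
  have h0 := hR 0
  have hC : 0 ≤ 24 * (2 * (d : ℝ) + 1) * (1 + 4 * (d : ℝ)) ^ j * (R.Gfr 0 * |U|) := by positivity
  calc ∑ m ∈ Ioc n₀ N, lowSize d (pieceSize R U m) j
      ≤ ∑ m ∈ Ioc n₀ N, 24 * (2 * (d : ℝ) + 1) * (1 + 4 * (d : ℝ)) ^ j * (R.Gfr 0 * |U|) * ((16 : ℝ) ^ m)⁻¹ :=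
        Finset.sum_le_sum fun m _ => by
          have h := lowSize_le_bernstein d (pieceSize R U m) j
          rw [pieceSize_zero_eq] at h
          linarith
    _ = 24 * (2 * (d : ℝ) + 1) * (1 + 4 * (d : ℝ)) ^ j * (R.Gfr 0 * |U|) * ∑ m ∈ Ioc n₀ N, ((16 : ℝ) ^ m)⁻¹ := by
        rw [Finset.mul_sum]
    _ ≤ _ := mul_le_mul_of_nonneg_left (sum_Ioc_sixteen_inv_le n₀ N) hC

/-- The high parts up to slot `n₀ + k` at order `3` sum to at most `4·Gfr₃U²4^{n₀+k+1}/3`. -/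
theorem sum_highSize_three_le {R : RenConsts} (hR : ∀ j, 0 ≤ R.Gfr j) (U : ℝ) (n₀ k : ℕ) :
    ∑ m ∈ Ioc n₀ (n₀ + k), 4 * anchorSize (pieceSize R U m) 3 ≤ 4 * (R.Gfr 3 * U ^ 2 * ((4 : ℝ) ^ (n₀ + k + 1) / 3)) := by
  have hsub : Ioc n₀ (n₀ + k) ⊆ range (n₀ + k + 1) := fun m hm => by
    have := Finset.mem_Ioc.mp hm; exact mem_range.mpr (by omega)
  have hann := pieceSize_nonneg hR U
  calc ∑ m ∈ Ioc n₀ (n₀ + k), 4 * anchorSize (pieceSize R U m) 3 = ∑ m ∈ Ioc n₀ (n₀ + k), 4 * pieceSize R U m 3 := by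
        simp [anchorSize]
    _ ≤ ∑ m ∈ range (n₀ + k + 1), 4 * pieceSize R U m 3 :=
        Finset.sum_le_sum_of_subset_of_nonneg hsub fun m _ _ => by have := hann m 3; positivity
    _ = 4 * ∑ m ∈ range (n₀ + k + 1), pieceSize R U m 3 := by rw [Finset.mul_sum]
    _ ≤ _ := mul_le_mul_of_nonneg_left (sum_pieceSize_three_le hR U _) (by norm_num)

/-- The high parts up to slot `n₀ + k` at order `4` sum to at most `4·Gfr₄U²16^{n₀+k+1}/15`. -/
theorem sum_highSize_four_le {R : RenConsts} (hR : ∀ j, 0 ≤ R.Gfr j) (U : ℝ) (n₀ k : ℕ) :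
    ∑ m ∈ Ioc n₀ (n₀ + k), 4 * anchorSize (pieceSize R U m) 4 ≤ 4 * (R.Gfr 4 * U ^ 2 * ((16 : ℝ) ^ (n₀ + k + 1) / 15)) := by
  have hsub : Ioc n₀ (n₀ + k) ⊆ range (n₀ + k + 1) := fun m hm => by
    have := Finset.mem_Ioc.mp hm; exact mem_range.mpr (by omega)
  have hann := pieceSize_nonneg hR U
  calc ∑ m ∈ Ioc n₀ (n₀ + k), 4 * anchorSize (pieceSize R U m) 4 = ∑ m ∈ Ioc n₀ (n₀ + k), 4 * pieceSize R U m 4 := by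
        simp [anchorSize]
    _ ≤ ∑ m ∈ range (n₀ + k + 1), 4 * pieceSize R U m 4 :=
        Finset.sum_le_sum_of_subset_of_nonneg hsub fun m _ _ => by have := hann m 4; positivity
    _ = 4 * ∑ m ∈ range (n₀ + k + 1), pieceSize R U m 4 := by rw [Finset.mul_sum]
    _ ≤ _ := mul_le_mul_of_nonneg_left (sum_pieceSize_four_le hR U _) (by norm_num)

/-- **The graded order-3 sum is below `msA3G`** (every chain position `k`). -/
theorem chainSizeSumG_three_le_msA3G {R : RenConsts} (hR : ∀ j, 0 ≤ R.Gfr j) (U : ℝ) (d : ℕ) (Kp : ℕ → TrigPolyC4v) (n₀ N k : ℕ) :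
    chainSizeSumG d Kp (pieceSize R U) n₀ N k 3 ≤ msA3G R U d n₀ k := by
  have h1 := sum_pieceSize_three_le hR U n₀
  have h2 := sum_lowSize_pieceSize_le hR U d n₀ N 3
  have h3 := sum_highSize_three_le hR U n₀ k
  unfold chainSizeSumG msA3G
  rw [if_neg (by norm_num)]
  linarith

/-- **The graded order-4 sum is below `msA4G`** (every chain position `k`). -/
theorem chainSizeSumG_four_le_msA4G {R : RenConsts} (hR : ∀ j, 0 ≤ R.Gfr j) (U : ℝ) (d : ℕ) (Kp : ℕ → TrigPolyC4v) (n₀ N k : ℕ) :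
    chainSizeSumG d Kp (pieceSize R U) n₀ N k 4 ≤ msA4G R U d n₀ k := by
  have h1 := sum_pieceSize_four_le hR U n₀
  have h2 := sum_lowSize_pieceSize_le hR U d n₀ N 4
  have h3 := sum_highSize_four_le hR U n₀ k
  unfold chainSizeSumG msA4G
  rw [if_neg (by norm_num)]
  linarith

/-- **THE GRADED CHAIN REGIME FROM THE PIECES**: in the KL regime with the chain thresholds, the uniform `C²` facts of `chain_regime_of_pieces`
(`A = msA R c U`; the graded sums are below the uniform ones) and the DEPTH-GRADED order-3/4 budgets `msA3G`, `msA4G` at every chain position. -/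
theorem chain_regime_of_pieces_graded {R : RenConsts} (hR : ∀ j, 0 ≤ R.Gfr j) {c : ℝ} (hc : 0 < c) (hcle : c ≤ klCurveC3 R / 16)
    {U : ℝ} (hU : 0 < U) (hUle : U ≤ klCurveU0 R / 16) {β : ℝ} (hβmin : klBetaMin ≤ β) (hβc : β ≤ Real.exp (c / U ^ 2))
    {μ : ℝ} (hμ : μ ∈ klWindowC) {Kp : ℕ → TrigPolyC4v}
    (ha : ∀ m ≤ nScales β, ∀ j ≤ 4, ∀ q : Momentum, ‖iteratedFDeriv ℝ j (evalM (Kp m)) q‖ ≤ pieceSize R U m j)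
    (d : ℕ) {n : ℕ} (hn : n ≤ nScales β) :
    (∀ j ≤ 2, chainSizeSumG d Kp (pieceSize R U) n (nScales β) (nScales β - n) j ≤ msA R c U) ∧ msA R c U ≤ 1 / 20 ∧
    klCurveD ≤ (bandBounds (show (-4 : ℝ) < -1.1 by norm_num) (show (-1.1 : ℝ) ≤ -0.1 by norm_num)
      (show (-0.1 : ℝ) < 0 by norm_num)).Dtmin - 2 * msA R c U ∧
    ((-1.1 : ℝ) ≤ μ - msA R c U ∧ μ + msA R c U ≤ -0.1) ∧
    (∀ k ≤ nScales β - n, chainSizeSumG d Kp (pieceSize R U) n (nScales β) k 3 ≤ msA3G R U d n k) ∧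
    (∀ k ≤ nScales β - n, chainSizeSumG d Kp (pieceSize R U) n (nScales β) k 4 ≤ msA4G R U d n k) := by
  obtain ⟨hA, hA20, hd, hmar, -, -⟩ := chain_regime_of_pieces hR hc hcle hU hUle hβmin hβc hμ ha hn
  have hann := pieceSize_nonneg hR U
  exact ⟨fun j hj => (chainSizeSumG_le_chainSizeSum d hn hann le_rfl j).trans (hA j hj), hA20, hd, hmar,
    fun k _ => chainSizeSumG_three_le_msA3G hR U d Kp n _ k, fun k _ => chainSizeSumG_four_le_msA4G hR U d Kp n _ k⟩

/-! ## §2 The computed sizes, keyed by the pieces -/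

/-- **The computed BASE size keyed by the pieces, depth-graded, oscillation entry**: `msSizeBaseO X σ (msA3G R U d n₀ 0) (msA4G R U d n₀ 0)`. -/
def msPieceBaseG (X : ℝ) (σ : ℕ → ℕ → ℝ) (R : RenConsts) (U : ℝ) (d n₀ : ℕ) : ℕ → ℝ :=
  msSizeBaseO X σ (msA3G R U d n₀ 0) (msA4G R U d n₀ 0)

/-- **The computed SLOT size keyed by the pieces, depth-graded, oscillation entry** (slot `m`, chain position `m − n₀`):
`msSizeSlotO X σ ε (msA R c U) (msA3G R U d n₀ (m−n₀)) (msA4G R U d n₀ (m−n₀)) msDt (m ↦ msE d (pieceSize R U m)) n₀ m j`. -/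
def msPieceSlotG (X : ℝ) (σ ε : ℕ → ℕ → ℝ) (R : RenConsts) (c U : ℝ) (d n₀ : ℕ) : ℕ → ℕ → ℝ := fun m j =>
  msSizeSlotO X σ ε (msA R c U) (msA3G R U d n₀ (m - n₀)) (msA4G R U d n₀ (m - n₀)) msDt (fun m => msE d (pieceSize R U m)) n₀ m j

/-- **The computed TOP size** (`FrameOK`-keyed, one symbol, oscillation entry): `extSize X (σ 0) (bellCumOsc σ (msD (topA3 R U N) (topA4 R U N)) j) j`. -/
def msPieceTop (X : ℝ) (σ : ℕ → ℝ) (R : RenConsts) (U : ℝ) (N j : ℕ) : ℝ :=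
  extSize X (σ 0) (bellCumOsc σ (msD (topA3 R U N) (topA4 R U N)) j) j

/-- `msPieceBaseG` unfolded to the literal shape of a fit hypothesis `hfit_n`. -/
theorem msPieceBaseG_eq (X : ℝ) (σ : ℕ → ℕ → ℝ) (R : RenConsts) (U : ℝ) (d n₀ j : ℕ) : msPieceBaseG X σ R U d n₀ j =
    (if j = 0 then σ 0 0 else 0) +
      (j.factorial : ℝ) ^ 2 * (2 * j.factorial * X * 200 ^ j) *
        bellCumOsc (σ 0) (msD (msA3G R U d n₀ 0) (msA4G R U d n₀ 0)) j * (4 + max 1 (((j - 1).factorial : ℝ) / (8 / 5))) ^ j := rfl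

/-- `msPieceSlotG` unfolded to the literal shape of a fit hypothesis `hfit_m`. -/
theorem msPieceSlotG_eq (X : ℝ) (σ ε : ℕ → ℕ → ℝ) (R : RenConsts) (c U : ℝ) (d n₀ m j : ℕ) : msPieceSlotG X σ ε R c U d n₀ m j =
    (if j = 0 then ε m 0 + σ (m - n₀ - 1) 1 *
        msdD (msA R c U) (msA3G R U d n₀ (m - n₀)) (msA4G R U d n₀ (m - n₀)) msDt (msE d (pieceSize R U m)) 0 else 0) +
      (j.factorial : ℝ) ^ 2 * (2 * j.factorial * X * 200 ^ j) *
        (bellCumOsc (ε m) (msD (msA3G R U d n₀ (m - n₀)) (msA4G R U d n₀ (m - n₀))) j +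
          bellDiffCum (σ (m - n₀ - 1)) (msD (msA3G R U d n₀ (m - n₀)) (msA4G R U d n₀ (m - n₀)))
            (msdD (msA R c U) (msA3G R U d n₀ (m - n₀)) (msA4G R U d n₀ (m - n₀)) msDt (msE d (pieceSize R U m))) j) *
        (4 + max 1 (((j - 1).factorial : ℝ) / (8 / 5))) ^ j := rfl

/-- `msPieceTop` unfolded to the literal left-hand side of g3's top `hfit`. -/
theorem msPieceTop_eq (X : ℝ) (σ : ℕ → ℝ) (R : RenConsts) (U : ℝ) (N j : ℕ) : msPieceTop X σ R U N j =
    (if j = 0 then σ 0 else 0) +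
      (j.factorial : ℝ) ^ 2 * (2 * j.factorial * X * 200 ^ j) *
        bellCumOsc σ (msD (topA3 R U N) (topA4 R U N)) j * (4 + max 1 (((j - 1).factorial : ℝ) / (8 / 5))) ^ j := rfl

/-! ## §3 The three supplier theorems, parametric, depth-graded (no fit) -/

section MS

variable {L M : ℕ} [NeZero L] [NeZero M] {R : RenConsts} {β U μ : ℝ}

/-! ### The top scale, frame-size keyed, oscillation entry (here rather than in the table file, for size) -/

/-- **(E3a-MS), parametric, AT THE TOP SCALE `nScales β + 1`, frame-size keyed, oscillation entry** — as `twoLegSizesMSWith_top_of_sizes`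
(`…MSWithChain`) with the base size `extSize X (σ 0) (bellCumOsc σ (msD A₃ A₄) j) j` (repair «MS-A0» at the top: at small `β` the top scale is
shallow and the `2·σ 0` entry of `bellCum` is tadpole-sized there too). -/
theorem twoLegSizesMSWith_top_of_sizes_osc (hμ : μ ∈ klWindowC) {K : TrigPolyC4v}
    (hc₁ : Continuous (klLocalPart L M β U μ K (nScales β + 1))) (hc₀ : Continuous (klLocalPart L M β U μ K (nScales β)))
    {S : TrigPolyC4v}
    (hS : ∀ θ, klLocalPart L M β U μ K (nScales β + 1) θ - klLocalPart L M β U μ K (nScales β) θ = S.eval (klFermiPoint μ K θ))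
    {A : ℝ} (hA : ∀ p : Momentum, ∀ j ≤ 2, ‖iteratedFDeriv ℝ j (frameShift K) p‖ ≤ A) (hA20 : A ≤ 1 / 20)
    (hd : klCurveD ≤ (bandBounds (show (-4 : ℝ) < -1.1 by norm_num) (show (-1.1 : ℝ) ≤ -0.1 by norm_num)
      (show (-0.1 : ℝ) < 0 by norm_num)).Dtmin - 2 * A)
    (hlo : (-1.1 : ℝ) ≤ μ - A) (hhi : μ + A ≤ -0.1)
    {A₃ A₄ : ℝ} (hA₃ : ∀ p : Momentum, ‖iteratedFDeriv ℝ 3 (frameShift K) p‖ ≤ A₃)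
    (hA₄ : ∀ p : Momentum, ‖iteratedFDeriv ℝ 4 (frameShift K) p‖ ≤ A₄)
    {σ : ℕ → ℝ} (hσnn : ∀ l, 0 ≤ σ l) (hσ0 : ∀ q : Momentum, |evalM S q| ≤ σ 0)
    (hσ : ∀ l, 1 ≤ l → l ≤ 4 → ∀ q : Momentum, ‖iteratedFDeriv ℝ l (evalM S) q‖ ≤ σ l)
    {X : ℝ} (hX : ∀ l ≤ 4, ∀ x : ℝ, ‖iteratedFDeriv ℝ l salmhoferCutoff x‖ ≤ X) (B : ℕ → ℕ → ℝ) :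
    TwoLegSizesMSWith L M β U μ K.eval (nScales β + 1) (fun j => extSize X (σ 0) (bellCumOsc σ (msD A₃ A₄) j) j) B := by
  set N := nScales β with hNdef
  have hX0 : 0 ≤ X := cutoffNumeral_nonneg hX
  -- the curve of `K`
  have hcurve := fermiPointLp_sizes_of_sizes hA hA20 hd hlo hhi hA₃ hA₄
  have hC : ContDiff ℝ 4 (fun θ : ℝ => (WithLp.toLp 2 (klFermiPoint μ K θ) : Momentum)) := (hcurve 0).1
  have hC' : ContDiff ℝ 4 (klFermiPoint μ K) := contDiff_of_contDiff_toLp hC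
  have hD : ∀ i, 1 ≤ i → i ≤ 4 → ∀ θ,
      ‖iteratedDeriv i (fun θ : ℝ => (WithLp.toLp 2 (klFermiPoint μ K θ) : Momentum)) θ‖ ≤ msD A₃ A₄ i := by
    intro i hi1 hi4 θ
    obtain ⟨-, d1, d2, d3, d4⟩ := hcurve θ
    rw [← norm_iteratedFDeriv_eq_norm_iteratedDeriv]
    interval_cases i
    · exact d1
    · exact d2
    · exact d3
    · exact d4
  have hDnn : ∀ i, 0 ≤ msD A₃ A₄ i := by
    intro i
    rcases i with _ | _ | _ | _ | _ | i
    · simp [msD]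
    · exact (norm_nonneg _).trans (hD 1 le_rfl (by norm_num) 0)
    · exact (norm_nonneg _).trans (hD 2 (by norm_num) (by norm_num) 0)
    · exact (norm_nonneg _).trans (hD 3 (by norm_num) (by norm_num) 0)
    · exact (norm_nonneg _).trans (hD 4 (by norm_num) (by norm_num) 0)
    · simp [msD]
  -- the piece
  have hδ : (fun θ => klLocalPart L M β U μ K (N + 1) θ - klLocalPart L M β U μ K N θ) = curveProfile μ S K := by
    funext θ; rw [hS θ]; rfl
  have hP : klTwoLegPieceFn L M β U μ K.eval (N + 1) = klFrameExtFn μ (curveProfile μ S K) := by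
    rw [klTwoLegPieceFn_eval_succ β U μ K N hc₁ hc₀, hδ]
  -- the (trivial) split
  set p : ℕ → ℝ → ℝ := fun m => if m = N + 1 then curveProfile μ S K else fun _ => 0 with hpdef
  have hpN : p (N + 1) = curveProfile μ S K := by simp [hpdef]
  have hpm : ∀ m, m ≠ N + 1 → p m = fun _ => 0 := fun m hm => by simp [hpdef, hm]
  have hempty : Ioc (N + 1) (nScales β) = ∅ := Finset.Ioc_eq_empty_of_le (by omega)
  have hW := twoLegSizesMSWith_of_profile_split hμ hP p ?_ ?_ ?_ ?_ ?_ hX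
    (fun m j => if m = N + 1 then bellCumOsc σ (msD A₃ A₄) j else 0) ?_
  · refine hW.mono ?_ ?_
    · intro j _
      rw [if_pos rfl, hpN]
      refine extSize_mono hX0 (abs_klAngularMean_le' fun θ => ?_) le_rfl j
      rw [curveProfile_apply]; exact hσ0 _
    · intro m hm
      rw [hempty] at hm
      exact absurd hm (Finset.notMem_empty m)
  · intro θ; rw [hempty, Finset.sum_empty, hpN, add_zero]
  · intro m
    by_cases hm : m = N + 1
    · subst hm; rw [hpN]; exact contDiff_curveProfile μ S K hC'
    · rw [hpm m hm]; exact contDiff_const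
  · intro m θ
    by_cases hm : m = N + 1
    · subst hm; simp only [hpN, curveProfile, klFermiPoint_periodic μ _ θ]
    · simp only [hpm m hm]
  · intro m θ
    by_cases hm : m = N + 1
    · subst hm; simp only [hpN, curveProfile, klFermiPoint_neg, TrigPolyC4v.eval_reflect]
    · simp only [hpm m hm]
  · intro m θ
    by_cases hm : m = N + 1
    · subst hm; simp only [hpN, curveProfile, klFermiPoint_pi_div_two_sub, TrigPolyC4v.eval_swap]
    · simp only [hpm m hm]
  · intro m j hj i hi t
    by_cases hm : m = N + 1
    · subst hm
      rw [hpN, if_pos rfl]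
      exact curveProfile_centred_sizes_osc μ S K hC hσnn hDnn hσ0 hσ hD hj hi t
    · rw [hpm m hm, if_neg hm, klAngularMean_zero]
      simp


/-- **(E3a-MS), parametric and depth-graded, AT SCALE `n+1` IN THE KL REGIME, KEYED BY THE ADMISSIBLE PIECES** — binders of
`twoLegSizesMST_succ_of_pieces` (`…MSOfPieces`) minus the two fits; conclusion the slot text at the computed sizes `msPieceBaseG` / `msPieceSlotG`
(no `nScales β` in either: base `∝` scale-`n₀` budgets, slot `m` `∝` depth-`m` budgets). -/
theorem twoLegSizesMSWith_succ_of_pieces_graded (hR : ∀ j, 0 ≤ R.Gfr j) {c : ℝ} (hc : 0 < c) (hcle : c ≤ klCurveC3 R / 16)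
    (hU : 0 < U) (hUle : U ≤ klCurveU0 R / 16) (hβmin : klBetaMin ≤ β) (hβc : β ≤ Real.exp (c / U ^ 2)) (hμ : μ ∈ klWindowC)
    {K : TrigPolyC4v} {Kp : ℕ → TrigPolyC4v} (hK : ∀ p : Fin 2 → ℝ, K.eval p = ∑ m ∈ range (nScales β + 1), (Kp m).eval p)
    (ha : ∀ m ≤ nScales β, ∀ j ≤ 4, ∀ q : Momentum, ‖iteratedFDeriv ℝ j (evalM (Kp m)) q‖ ≤ pieceSize R U m j)
    {n : ℕ} (hn : n + 1 ≤ nScales β) (d : ℕ)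
    (hc₁ : Continuous (klLocalPart L M β U μ K (n + 1))) (hc₀ : Continuous (klLocalPart L M β U μ K n))
    {S : ℕ → TrigPolyC4v}
    (hS : ∀ θ, klLocalPart L M β U μ K (n + 1) θ - klLocalPart L M β U μ K n θ =
      (S (nScales β - (n + 1))).eval (klFermiPoint μ K θ))
    {σ : ℕ → ℕ → ℝ} (hσnn : ∀ k l, 0 ≤ σ k l)
    (hσ0 : ∀ k ≤ nScales β - (n + 1), ∀ q : Momentum, |evalM (S k) q| ≤ σ k 0)
    (hσ : ∀ k ≤ nScales β - (n + 1), ∀ l, 1 ≤ l → l ≤ 5 → ∀ q : Momentum, ‖iteratedFDeriv ℝ l (evalM (S k)) q‖ ≤ σ k l)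
    {ε : ℕ → ℕ → ℝ} (hεnn : ∀ m l, 0 ≤ ε m l)
    (hε0 : ∀ m ∈ Ioc (n + 1) (nScales β), ∀ q : Momentum, |evalM (fsub (S (m - (n + 1))) (S (m - (n + 1) - 1))) q| ≤ ε m 0)
    (hε : ∀ m ∈ Ioc (n + 1) (nScales β), ∀ l, 1 ≤ l → l ≤ 4 → ∀ q : Momentum,
      ‖iteratedFDeriv ℝ l (evalM (fsub (S (m - (n + 1))) (S (m - (n + 1) - 1)))) q‖ ≤ ε m l)
    {X : ℝ} (hX : ∀ l ≤ 4, ∀ x : ℝ, ‖iteratedFDeriv ℝ l salmhoferCutoff x‖ ≤ X) :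
    TwoLegSizesMSWith L M β U μ K.eval (n + 1) (msPieceBaseG X σ R U d (n + 1)) (msPieceSlotG X σ ε R c U d (n + 1)) := by
  obtain ⟨hA, hA20, hd, ⟨hlo, hhi⟩, hA₃, hA₄⟩ := chain_regime_of_pieces_graded hR hc hcle hU hUle hβmin hβc hμ ha d (n := n + 1) hn
  have he : ∀ m ∈ Ioc (n + 1) (nScales β), ∀ j ≤ 4, ∀ q : Momentum,
      ‖iteratedFDeriv ℝ j (evalM (highPart d (Kp m))) q‖ ≤ msE d (pieceSize R U m) j :=
    fun m hm j hj q => norm_iteratedFDeriv_evalM_highPart_le_msE d (ha m (Finset.mem_Ioc.mp hm).2) hj q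
  exact twoLegSizesMSWith_succ_of_chainF_table_graded hμ hK hn d hc₁ hc₀ hS (pieceSize_nonneg hR U) ha hA hA20 hd hlo hhi hA₃ hA₄
    hσnn hσ0 hσ hεnn hε0 hε he hX

/-- **(E3a-MS), parametric and depth-graded, AT SCALE `0` IN THE KL REGIME, KEYED BY THE ADMISSIBLE PIECES** — binders of
`twoLegSizesMST_zero_of_pieces` minus the two fits; conclusion the slot text at the computed sizes `msPieceBaseG … 0` / `msPieceSlotG … 0`. -/
theorem twoLegSizesMSWith_zero_of_pieces_graded (hR : ∀ j, 0 ≤ R.Gfr j) {c : ℝ} (hc : 0 < c) (hcle : c ≤ klCurveC3 R / 16)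
    (hU : 0 < U) (hUle : U ≤ klCurveU0 R / 16) (hβmin : klBetaMin ≤ β) (hβc : β ≤ Real.exp (c / U ^ 2)) (hμ : μ ∈ klWindowC)
    {K : TrigPolyC4v} {Kp : ℕ → TrigPolyC4v} (hK : ∀ p : Fin 2 → ℝ, K.eval p = ∑ m ∈ range (nScales β + 1), (Kp m).eval p)
    (ha : ∀ m ≤ nScales β, ∀ j ≤ 4, ∀ q : Momentum, ‖iteratedFDeriv ℝ j (evalM (Kp m)) q‖ ≤ pieceSize R U m j)
    (d : ℕ) (hc₀ : Continuous (klLocalPart L M β U μ K 0))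
    {S : ℕ → TrigPolyC4v}
    (hS : ∀ θ, klLocalPart L M β U μ K 0 θ - K.eval (klFermiPoint μ K θ) = (S (nScales β)).eval (klFermiPoint μ K θ))
    {σ : ℕ → ℕ → ℝ} (hσnn : ∀ k l, 0 ≤ σ k l)
    (hσ0 : ∀ k ≤ nScales β, ∀ q : Momentum, |evalM (S k) q| ≤ σ k 0)
    (hσ : ∀ k ≤ nScales β, ∀ l, 1 ≤ l → l ≤ 5 → ∀ q : Momentum, ‖iteratedFDeriv ℝ l (evalM (S k)) q‖ ≤ σ k l)
    {ε : ℕ → ℕ → ℝ} (hεnn : ∀ m l, 0 ≤ ε m l)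
    (hε0 : ∀ m ∈ Ioc 0 (nScales β), ∀ q : Momentum, |evalM (fsub (S m) (S (m - 1))) q| ≤ ε m 0)
    (hε : ∀ m ∈ Ioc 0 (nScales β), ∀ l, 1 ≤ l → l ≤ 4 → ∀ q : Momentum,
      ‖iteratedFDeriv ℝ l (evalM (fsub (S m) (S (m - 1)))) q‖ ≤ ε m l)
    {X : ℝ} (hX : ∀ l ≤ 4, ∀ x : ℝ, ‖iteratedFDeriv ℝ l salmhoferCutoff x‖ ≤ X) :
    TwoLegSizesMSWith L M β U μ K.eval 0 (msPieceBaseG X σ R U d 0) (msPieceSlotG X σ ε R c U d 0) := by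
  obtain ⟨hA, hA20, hd, ⟨hlo, hhi⟩, hA₃, hA₄⟩ :=
    chain_regime_of_pieces_graded hR hc hcle hU hUle hβmin hβc hμ ha d (n := 0) (Nat.zero_le _)
  have he : ∀ m ∈ Ioc 0 (nScales β), ∀ j ≤ 4, ∀ q : Momentum,
      ‖iteratedFDeriv ℝ j (evalM (highPart d (Kp m))) q‖ ≤ msE d (pieceSize R U m) j :=
    fun m hm j hj q => norm_iteratedFDeriv_evalM_highPart_le_msE d (ha m (Finset.mem_Ioc.mp hm).2) hj q
  exact twoLegSizesMSWith_zero_of_chainF_table_graded hμ hK d hc₀ hS (pieceSize_nonneg hR U) ha hA hA20 hd hlo hhi hA₃ hA₄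
    hσnn hσ0 hσ hεnn hε0 hε he hX

/-- **(E3a-MS), parametric, AT THE TOP SCALE IN THE KL REGIME** (`FrameOK`-keyed, thresholds `klCurveC3 R`, `klCurveU0 R`) — binders of
`twoLegSizesMST_top_of_frameOK` minus the fit; conclusion the slot text at the computed base size `msPieceTop` (slot family arbitrary; at the top
the full-frame budgets `topA3/topA4` are the right scale, so nothing is graded here; oscillation entry). -/
theorem twoLegSizesMSWith_top_of_frameOK (hR : ∀ j, 0 ≤ R.Gfr j) {c : ℝ} (hc : 0 < c) (hcle : c ≤ klCurveC3 R)
    (hU : 0 < U) (hUle : U ≤ klCurveU0 R) (hβmin : klBetaMin ≤ β) (hβc : β ≤ Real.exp (c / U ^ 2)) (hμ : μ ∈ klWindowC)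
    {K : TrigPolyC4v} (hK : FrameOK R U (nScales β) μ K)
    (hc₁ : Continuous (klLocalPart L M β U μ K (nScales β + 1))) (hc₀ : Continuous (klLocalPart L M β U μ K (nScales β)))
    {S : TrigPolyC4v}
    (hS : ∀ θ, klLocalPart L M β U μ K (nScales β + 1) θ - klLocalPart L M β U μ K (nScales β) θ = S.eval (klFermiPoint μ K θ))
    {σ : ℕ → ℝ} (hσnn : ∀ l, 0 ≤ σ l) (hσ0 : ∀ q : Momentum, |evalM S q| ≤ σ 0)
    (hσ : ∀ l, 1 ≤ l → l ≤ 4 → ∀ q : Momentum, ‖iteratedFDeriv ℝ l (evalM S) q‖ ≤ σ l)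
    {X : ℝ} (hX : ∀ l ≤ 4, ∀ x : ℝ, ‖iteratedFDeriv ℝ l salmhoferCutoff x‖ ≤ X) (B : ℕ → ℕ → ℝ) :
    TwoLegSizesMSWith L M β U μ K.eval (nScales β + 1) (msPieceTop X σ R U (nScales β)) B := by
  obtain ⟨hAf, hA20, -, hhalf, ⟨hlo, hhi⟩, hA3f, hA4f⟩ := frame_sizes_of_frameOK_explicit hR hc hcle hU hUle hβmin hβc hμ hK
  exact twoLegSizesMSWith_top_of_sizes_osc hμ hc₁ hc₀ hS hAf hA20 hhalf hlo hhi hA3f hA4f hσnn hσ0 hσ hX B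

end MS

end Summit.HubbardSuperconductivity.HubbardSuperconductivity.Theorems.KLRegimeSplit

end
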